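import Summits.Ventures.PercRepro.MSTightCompletionDichotomy
import Summits.Ventures.PercRepro.MSTightCompletion0Lost
import Summits.Ventures.PercRepro.MSTightTwinFreeProduct

/-!
# The product coordinates of a tight completion (shape A): `F₀ = L ⊻ U₀`, `P = L ⊻ U`

Dossier proofs/MINE1-theoremS.md, Addendum 57 §2; HANDOFF §mine-1 gen 32 → 33, step (K1). Setting:
`F` twin-free with empty core and SHAPE A — the completion `G = completion0 r F = F₀ ∪ (P + r)`
(`F₀ = part0 r F`, `P = proj r F`) is tight. Then `G` is twin-free (`twinFree_completion0`) and `r`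
is addable for it (`r_mem_Rstar_completion0`), so Theorem S in the flip form (`mem_iff_parts`)
describes `G` by the parts of its members outside / inside `R̃ = Rstar G`. With `M := R̃.erase r`
(`cM`), `L := {x ∈ G \\ G : x ⊆ univ ∖ R̃}` (`cL`), `U := {y ⊆ M : M ∖ y ∈ G \\ G}` (`cU`) and
`U₀ := {y ⊆ M : insert r (M ∖ y) ∈ G \\ G}` (`cU0`): a set `A` avoiding `r` lies in `P` iff
`A ∖ M ∈ L ∧ A ∩ M ∈ U` (`mem_proj_iff_coords`) and in `F₀` iff `A ∖ M ∈ L ∧ A ∩ M ∈ U₀`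
(`mem_part0_iff_coords`); in product form **`proj r F = L ⊻ U`** and **`part0 r F = L ⊻ U₀`**
(`proj_eq_sups_cL_cU`, `part0_eq_sups_cL_cU0`). `L` is a down-set containing `∅`, `U₀ ⊆ U` are
up-sets within `M`, and `M ∈ U₀` — the coordinates of the fibre identity and of (ROW-a) (K2–K3).
-/

namespace PercRepro.MSTight

open Finset
open scoped FinsetFamily

variable {α : Type*} [DecidableEq α] [Fintype α] {F : Finset (Finset α)} {r : α}

section Completion

omit [Fintype α] in
/-- Membership in the completion `F₀ ∪ (P + r)`. -/
theorem mem_completion0 {A : Finset α} :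
    A ∈ completion0 r F ↔ A ∈ part0 r F ∨ ∃ p ∈ proj r F, insert r p = A := by
  simp [completion0]

omit [Fintype α] in
/-- Every member of the trace, with `r` added, is a member of the completion. -/
theorem insert_mem_completion0_of_mem_proj {p : Finset α} (hp : p ∈ proj r F) :
    insert r p ∈ completion0 r F :=
  mem_completion0.2 (Or.inr ⟨p, hp, rfl⟩)

omit [Fintype α] in
/-- The completion is nonempty as soon as some member of `F` avoids `r`. -/
theorem completion0_nonempty (hcore : ∀ a, ∃ t ∈ F, a ∉ t) : (completion0 r F).Nonempty := by
  obtain ⟨t, ht, hrt⟩ := hcore r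
  exact ⟨t, mem_completion0.2 (Or.inl (mem_part0.2 ⟨ht, hrt⟩))⟩

omit [Fintype α] in
/-- **The completion of a twin-free family with empty core is twin-free.** -/
theorem twinFree_completion0 (htw : ∀ a b, Twin F a b → a = b) (hcore : ∀ a, ∃ t ∈ F, a ∉ t) :
    ∀ a b, Twin (completion0 r F) a b → a = b := by
  have key : ∀ b, Twin (completion0 r F) r b → b = r := by
    intro b hb
    by_contra hbr
    obtain ⟨t, ht, hbt⟩ := hcore b
    have hmem := insert_mem_completion0_of_mem_proj (r := r) (mem_proj.2 ⟨t, ht, rfl⟩)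
    have := (hb _ hmem).1 (mem_insert_self r _)
    rw [mem_insert, mem_erase] at this
    rcases this with h | ⟨_, h⟩
    · exact hbr h
    · exact hbt h
  intro a b hab
  by_cases har : a = r
  · subst har
    exact (key b hab).symm
  by_cases hbr : b = r
  · subst hbr
    exact key a hab.symm
  apply htw
  intro t ht
  have h := hab _ (insert_mem_completion0_of_mem_proj (r := r) (mem_proj.2 ⟨t, ht, rfl⟩))
  simpa [har, hbr] using h

/-- The twin class of `r` in the completion is `{r}`. -/
theorem cls_completion0_eq_singleton (htw : ∀ a b, Twin F a b → a = b)
    (hcore : ∀ a, ∃ t ∈ F, a ∉ t) : cls (completion0 r F) r = {r} := by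
  ext b
  rw [mem_cls, mem_singleton]
  constructor
  · intro h
    exact (twinFree_completion0 htw hcore r b h).symm
  · rintro rfl
    exact twin_refl _ _

/-- **`r` is addable for the completion**: `r ∈ Rstar (completion0 r F)`. -/
theorem r_mem_Rstar_completion0 (htw : ∀ a b, Twin F a b → a = b)
    (hcore : ∀ a, ∃ t ∈ F, a ∉ t) : r ∈ Rstar (completion0 r F) := by
  rw [mem_Rstar, cls_completion0_eq_singleton htw hcore]
  intro t ht
  rcases mem_completion0.1 ht with ht0 | ⟨p, hp, rfl⟩
  · have hpP : t ∈ proj r F := mem_proj_of_mem_part0 ht0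
    have : t ∪ {r} = insert r t := by rw [insert_eq, union_comm]
    rw [this]
    exact insert_mem_completion0_of_mem_proj hpP
  · have : insert r p ∪ {r} = insert r p := by
      rw [insert_eq, union_comm, ← union_assoc, union_self]
    rw [this]
    exact insert_mem_completion0_of_mem_proj hp

end Completion

section Coords

/-- `M`: the addable part of the completion, with `r` removed. -/
def cM (r : α) (F : Finset (Finset α)) : Finset α := (Rstar (completion0 r F)).erase r

/-- `L`: the differences of the completion avoiding its addable part. -/
def cL (r : α) (F : Finset (Finset α)) : Finset (Finset α) :=
  within (completion0 r F \\ completion0 r F) (univ \ Rstar (completion0 r F))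

/-- `U`: the subsets `y ⊆ M` with `M ∖ y` a difference of the completion. -/
def cU (r : α) (F : Finset (Finset α)) : Finset (Finset α) :=
  (cM r F).powerset.filter fun y => cM r F \ y ∈ completion0 r F \\ completion0 r F

/-- `U₀`: the subsets `y ⊆ M` with `insert r (M ∖ y)` a difference of the completion. -/
def cU0 (r : α) (F : Finset (Finset α)) : Finset (Finset α) :=
  (cM r F).powerset.filter fun y => insert r (cM r F \ y) ∈ completion0 r F \\ completion0 r F

/-- Membership in `L`. -/
theorem mem_cL {x : Finset α} :
    x ∈ cL r F ↔ x ∈ completion0 r F \\ completion0 r F ∧ x ⊆ univ \ Rstar (completion0 r F) :=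
  mem_within

/-- Membership in `U`. -/
theorem mem_cU {y : Finset α} :
    y ∈ cU r F ↔ y ⊆ cM r F ∧ cM r F \ y ∈ completion0 r F \\ completion0 r F := by
  simp [cU]

/-- Membership in `U₀`. -/
theorem mem_cU0 {y : Finset α} :
    y ∈ cU0 r F ↔ y ⊆ cM r F ∧ insert r (cM r F \ y) ∈ completion0 r F \\ completion0 r F := by
  simp [cU0]

/-- `r ∉ M`. -/
theorem r_notMem_cM : r ∉ cM r F := notMem_erase r _

/-- `M ⊆ R̃`. -/
theorem cM_subset_Rstar : cM r F ⊆ Rstar (completion0 r F) := erase_subset r _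

/-- A member of `L` avoids `R̃`. -/
theorem subset_of_mem_cL {x : Finset α} (hx : x ∈ cL r F) : x ⊆ univ \ Rstar (completion0 r F) :=
  (mem_cL.1 hx).2

/-- A member of `L` is disjoint from `M`. -/
theorem disjoint_cM_of_mem_cL {x : Finset α} (hx : x ∈ cL r F) : Disjoint x (cM r F) := by
  rw [disjoint_left]
  intro a hax haM
  exact (mem_sdiff.1 (subset_of_mem_cL hx hax)).2 (cM_subset_Rstar haM)

/-- A member of `L` avoids `r` (once `r` is addable). -/
theorem r_notMem_of_mem_cL (hr : r ∈ Rstar (completion0 r F)) {x : Finset α} (hx : x ∈ cL r F) :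
    r ∉ x := fun h => (mem_sdiff.1 (subset_of_mem_cL hx h)).2 hr

/-- A member of `U` lies inside `M`. -/
theorem subset_cM_of_mem_cU {y : Finset α} (hy : y ∈ cU r F) : y ⊆ cM r F := (mem_cU.1 hy).1

/-- A member of `U₀` lies inside `M`. -/
theorem subset_cM_of_mem_cU0 {y : Finset α} (hy : y ∈ cU0 r F) : y ⊆ cM r F := (mem_cU0.1 hy).1

/-- `L` is a down-set (the completion is twin-free and tight). -/
theorem isDownSet_cL (htw : ∀ a b, Twin F a b → a = b) (hcore : ∀ a, ∃ t ∈ F, a ∉ t)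
    (hC : Tight (completion0 r F)) : IsDownSet (cL r F) :=
  isDownSet_within (isDownSet_diffs_of_twinFree hC (twinFree_completion0 htw hcore)) _

/-- `∅ ∈ L`. -/
theorem empty_mem_cL (hcore : ∀ a, ∃ t ∈ F, a ∉ t) : (∅ : Finset α) ∈ cL r F :=
  mem_cL.2 ⟨empty_mem_diffs_of_nonempty (completion0_nonempty hcore), empty_subset _⟩

/-- `U₀ ⊆ U` (the differences of the completion form a down-set). -/
theorem cU0_subset_cU (htw : ∀ a b, Twin F a b → a = b) (hcore : ∀ a, ∃ t ∈ F, a ∉ t)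
    (hC : Tight (completion0 r F)) : cU0 r F ⊆ cU r F := by
  intro y hy
  obtain ⟨hyM, hyD⟩ := mem_cU0.1 hy
  exact mem_cU.2 ⟨hyM,
    isDownSet_diffs_of_twinFree hC (twinFree_completion0 htw hcore) _ hyD _ (subset_insert _ _)⟩

/-- `U` is an up-set within `M`. -/
theorem isUpSetWithin_cU (htw : ∀ a b, Twin F a b → a = b) (hcore : ∀ a, ∃ t ∈ F, a ∉ t)
    (hC : Tight (completion0 r F)) : IsUpSetWithin (cM r F) (cU r F) := by
  intro y hy y' hy'M hyy'
  obtain ⟨-, hyD⟩ := mem_cU.1 hy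
  exact mem_cU.2 ⟨hy'M, isDownSet_diffs_of_twinFree hC (twinFree_completion0 htw hcore) _ hyD _
    (sdiff_subset_sdiff (Subset.refl _) hyy')⟩

/-- `U₀` is an up-set within `M`. -/
theorem isUpSetWithin_cU0 (htw : ∀ a b, Twin F a b → a = b) (hcore : ∀ a, ∃ t ∈ F, a ∉ t)
    (hC : Tight (completion0 r F)) : IsUpSetWithin (cM r F) (cU0 r F) := by
  intro y hy y' hy'M hyy'
  obtain ⟨-, hyD⟩ := mem_cU0.1 hy
  exact mem_cU0.2 ⟨hy'M, isDownSet_diffs_of_twinFree hC (twinFree_completion0 htw hcore) _ hyD _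
    (insert_subset_insert _ (sdiff_subset_sdiff (Subset.refl _) hyy'))⟩

omit [Fintype α] in
/-- `{r}` is a difference of the completion. -/
theorem singleton_r_mem_diffs_completion0 (hcore : ∀ a, ∃ t ∈ F, a ∉ t) :
    ({r} : Finset α) ∈ completion0 r F \\ completion0 r F := by
  obtain ⟨t, ht, hrt⟩ := hcore r
  have h0 : t ∈ completion0 r F := mem_completion0.2 (Or.inl (mem_part0.2 ⟨ht, hrt⟩))
  have h1 : insert r t ∈ completion0 r F :=
    insert_mem_completion0_of_mem_proj (mem_proj.2 ⟨t, ht, erase_eq_of_notMem hrt⟩)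
  refine mem_diffs.2 ⟨insert r t, h1, t, h0, ?_⟩
  ext a
  simp only [mem_sdiff, mem_insert, mem_singleton]
  constructor
  · rintro ⟨h | h, h'⟩
    · exact h
    · exact absurd h h'
  · rintro rfl
    exact ⟨Or.inl rfl, hrt⟩

/-- `M ∈ U₀`. -/
theorem cM_mem_cU0 (hcore : ∀ a, ∃ t ∈ F, a ∉ t) : cM r F ∈ cU0 r F := by
  refine mem_cU0.2 ⟨Subset.refl _, ?_⟩
  rw [Finset.sdiff_self, insert_empty]
  exact singleton_r_mem_diffs_completion0 hcore

/-- For `A` avoiding `r`: `A ∖ M = A ∖ R̃`. -/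
theorem sdiff_cM_eq_sdiff_Rstar {A : Finset α} (hrA : r ∉ A) :
    A \ cM r F = A \ Rstar (completion0 r F) := by
  ext a
  simp only [cM, mem_sdiff, mem_erase, not_and]
  constructor
  · rintro ⟨haA, h⟩
    exact ⟨haA, h (fun har => hrA (har ▸ haA))⟩
  · rintro ⟨haA, haR⟩
    exact ⟨haA, fun _ => haR⟩

/-- For `A` avoiding `r` and `r` addable: `R̃ ∖ A = insert r (M ∖ A)`. -/
theorem Rstar_sdiff_eq_insert (hr : r ∈ Rstar (completion0 r F)) {A : Finset α} (hrA : r ∉ A) :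
    Rstar (completion0 r F) \ A = insert r (cM r F \ A) := by
  ext a
  simp only [cM, mem_sdiff, mem_insert, mem_erase]
  constructor
  · rintro ⟨haR, haA⟩
    by_cases har : a = r
    · exact Or.inl har
    · exact Or.inr ⟨⟨har, haR⟩, haA⟩
  · rintro (rfl | ⟨⟨-, haR⟩, haA⟩)
    · exact ⟨hr, hrA⟩
    · exact ⟨haR, haA⟩

/-- `R̃ ∖ insert r A = M ∖ A`. -/
theorem Rstar_sdiff_insert_eq (A : Finset α) :
    Rstar (completion0 r F) \ insert r A = cM r F \ A := by
  ext a
  simp only [cM, mem_sdiff, mem_insert, mem_erase, not_or]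
  constructor
  · rintro ⟨haR, har, haA⟩
    exact ⟨⟨har, haR⟩, haA⟩
  · rintro ⟨⟨har, haR⟩, haA⟩
    exact ⟨haR, har, haA⟩

/-- `M ∖ (A ∩ M) = M ∖ A`. -/
theorem cM_sdiff_inter_eq (A : Finset α) : cM r F \ (A ∩ cM r F) = cM r F \ A := by
  ext a
  simp only [mem_sdiff, mem_inter, not_and]
  constructor
  · rintro ⟨haM, h⟩
    exact ⟨haM, fun haA => h haA haM⟩
  · rintro ⟨haM, haA⟩
    exact ⟨haM, fun haA' _ => haA haA'⟩

/-- **The coordinates of a member of the trace**: for `A` avoiding `r`, `A ∈ P` iff `A ∖ M ∈ L`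
and `A ∩ M ∈ U`. -/
theorem mem_proj_iff_coords (htw : ∀ a b, Twin F a b → a = b) (hcore : ∀ a, ∃ t ∈ F, a ∉ t)
    (hC : Tight (completion0 r F)) {A : Finset α} (hrA : r ∉ A) :
    A ∈ proj r F ↔ A \ cM r F ∈ cL r F ∧ A ∩ cM r F ∈ cU r F := by
  have hr : r ∈ Rstar (completion0 r F) := r_mem_Rstar_completion0 htw hcore
  rw [← partr_completion0, mem_partr, mem_iff_parts hC, insert_sdiff_of_mem _ hr,
    Rstar_sdiff_insert_eq, mem_cL, mem_cU, sdiff_cM_eq_sdiff_Rstar hrA]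
  rw [cM_sdiff_inter_eq]
  constructor
  · rintro ⟨-, h1, h2⟩
    exact ⟨⟨h1, sdiff_subset_sdiff (subset_univ _) (Subset.refl _)⟩, inter_subset_right, h2⟩
  · rintro ⟨⟨h1, -⟩, -, h2⟩
    exact ⟨hrA, h1, h2⟩

/-- **The coordinates of an `r`-free member**: for `A` avoiding `r`, `A ∈ F₀` iff `A ∖ M ∈ L` and
`A ∩ M ∈ U₀`. -/
theorem mem_part0_iff_coords (htw : ∀ a b, Twin F a b → a = b) (hcore : ∀ a, ∃ t ∈ F, a ∉ t)
    (hC : Tight (completion0 r F)) {A : Finset α} (hrA : r ∉ A) :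
    A ∈ part0 r F ↔ A \ cM r F ∈ cL r F ∧ A ∩ cM r F ∈ cU0 r F := by
  have hr : r ∈ Rstar (completion0 r F) := r_mem_Rstar_completion0 htw hcore
  rw [← part0_completion0, mem_part0, mem_iff_parts hC, Rstar_sdiff_eq_insert hr hrA, mem_cL,
    mem_cU0, sdiff_cM_eq_sdiff_Rstar hrA]
  rw [cM_sdiff_inter_eq]
  constructor
  · rintro ⟨⟨h1, h2⟩, -⟩
    exact ⟨⟨h1, sdiff_subset_sdiff (subset_univ _) (Subset.refl _)⟩, inter_subset_right, h2⟩
  · rintro ⟨⟨h1, -⟩, -, h2⟩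
    exact ⟨⟨h1, h2⟩, hrA⟩

/-- A union `x ∪ y` with `x ∈ L`, `y ⊆ M` has coordinates `x` and `y`. -/
theorem union_sdiff_cM_eq {x y : Finset α} (hx : x ∈ cL r F) (hy : y ⊆ cM r F) :
    (x ∪ y) \ cM r F = x := by
  rw [union_sdiff_distrib, sdiff_eq_empty_iff_subset.2 hy, union_empty]
  exact (disjoint_cM_of_mem_cL hx).sdiff_eq_left

/-- A union `x ∪ y` with `x ∈ L`, `y ⊆ M` has `M`-part `y`. -/
theorem union_inter_cM_eq {x y : Finset α} (hx : x ∈ cL r F) (hy : y ⊆ cM r F) :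
    (x ∪ y) ∩ cM r F = y := by
  rw [union_inter_distrib_right, Finset.disjoint_iff_inter_eq_empty.1 (disjoint_cM_of_mem_cL hx),
    empty_union, inter_eq_left.2 hy]

/-- The members of `L ⊻ U` with `r` added avoid `r`. -/
theorem r_notMem_union (hr : r ∈ Rstar (completion0 r F)) {x y : Finset α} (hx : x ∈ cL r F)
    (hy : y ⊆ cM r F) : r ∉ x ∪ y := by
  rw [mem_union, not_or]
  exact ⟨r_notMem_of_mem_cL hr hx, fun h => r_notMem_cM (hy h)⟩

/-- `x ∪ y ∈ P` for `x ∈ L`, `y ∈ U`. -/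
theorem union_mem_proj (htw : ∀ a b, Twin F a b → a = b) (hcore : ∀ a, ∃ t ∈ F, a ∉ t)
    (hC : Tight (completion0 r F)) {x y : Finset α} (hx : x ∈ cL r F) (hy : y ∈ cU r F) :
    x ∪ y ∈ proj r F := by
  have hyM := subset_cM_of_mem_cU hy
  rw [mem_proj_iff_coords htw hcore hC (r_notMem_union (r_mem_Rstar_completion0 (r := r) htw hcore) hx hyM),
    union_sdiff_cM_eq hx hyM, union_inter_cM_eq hx hyM]
  exact ⟨hx, hy⟩

/-- `x ∪ y ∈ F₀` for `x ∈ L`, `y ∈ U₀`. -/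
theorem union_mem_part0 (htw : ∀ a b, Twin F a b → a = b) (hcore : ∀ a, ∃ t ∈ F, a ∉ t)
    (hC : Tight (completion0 r F)) {x y : Finset α} (hx : x ∈ cL r F) (hy : y ∈ cU0 r F) :
    x ∪ y ∈ part0 r F := by
  have hyM := subset_cM_of_mem_cU0 hy
  rw [mem_part0_iff_coords htw hcore hC (r_notMem_union (r_mem_Rstar_completion0 (r := r) htw hcore) hx hyM),
    union_sdiff_cM_eq hx hyM, union_inter_cM_eq hx hyM]
  exact ⟨hx, hy⟩

/-- The `M`-part of `x ∪ y ∈ P` (`x ∈ L`, `y ⊆ M`) lies in `U`. -/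
theorem mem_cU_of_union_mem_proj (htw : ∀ a b, Twin F a b → a = b) (hcore : ∀ a, ∃ t ∈ F, a ∉ t)
    (hC : Tight (completion0 r F)) {x y : Finset α} (hx : x ∈ cL r F) (hy : y ⊆ cM r F)
    (h : x ∪ y ∈ proj r F) : y ∈ cU r F := by
  rw [mem_proj_iff_coords htw hcore hC (r_notMem_union (r_mem_Rstar_completion0 (r := r) htw hcore) hx hy),
    union_inter_cM_eq hx hy] at h
  exact h.2

/-- The `M`-part of `x ∪ y ∈ F₀` (`x ∈ L`, `y ⊆ M`) lies in `U₀`. -/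
theorem mem_cU0_of_union_mem_part0 (htw : ∀ a b, Twin F a b → a = b)
    (hcore : ∀ a, ∃ t ∈ F, a ∉ t) (hC : Tight (completion0 r F)) {x y : Finset α} (hx : x ∈ cL r F)
    (hy : y ⊆ cM r F) (h : x ∪ y ∈ part0 r F) : y ∈ cU0 r F := by
  rw [mem_part0_iff_coords htw hcore hC (r_notMem_union (r_mem_Rstar_completion0 (r := r) htw hcore) hx hy),
    union_inter_cM_eq hx hy] at h
  exact h.2

omit [Fintype α] in
/-- Every member of the trace avoids `r`. -/
theorem r_notMem_of_mem_proj {A : Finset α} (hA : A ∈ proj r F) : r ∉ A := by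
  obtain ⟨B, -, rfl⟩ := mem_proj.1 hA
  exact notMem_erase r B

/-- The `N`-part of a member of the trace lies in `L`. -/
theorem sdiff_cM_mem_cL_of_mem_proj (htw : ∀ a b, Twin F a b → a = b)
    (hcore : ∀ a, ∃ t ∈ F, a ∉ t) (hC : Tight (completion0 r F)) {A : Finset α}
    (hA : A ∈ proj r F) : A \ cM r F ∈ cL r F :=
  ((mem_proj_iff_coords htw hcore hC (r_notMem_of_mem_proj hA)).1 hA).1

/-- The `M`-part of a member of the trace lies in `U`. -/
theorem inter_cM_mem_cU_of_mem_proj (htw : ∀ a b, Twin F a b → a = b)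
    (hcore : ∀ a, ∃ t ∈ F, a ∉ t) (hC : Tight (completion0 r F)) {A : Finset α}
    (hA : A ∈ proj r F) : A ∩ cM r F ∈ cU r F :=
  ((mem_proj_iff_coords htw hcore hC (r_notMem_of_mem_proj hA)).1 hA).2

/-- The `M`-part of an `r`-free member lies in `U₀`. -/
theorem inter_cM_mem_cU0_of_mem_part0 (htw : ∀ a b, Twin F a b → a = b)
    (hcore : ∀ a, ∃ t ∈ F, a ∉ t) (hC : Tight (completion0 r F)) {A : Finset α}
    (hA : A ∈ part0 r F) : A ∩ cM r F ∈ cU0 r F :=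
  ((mem_part0_iff_coords htw hcore hC (mem_part0.1 hA).2).1 hA).2

/-- **The trace is the product `L ⊻ U`** (Addendum 57 §2). -/
theorem proj_eq_sups_cL_cU (htw : ∀ a b, Twin F a b → a = b) (hcore : ∀ a, ∃ t ∈ F, a ∉ t)
    (hC : Tight (completion0 r F)) : proj r F = cL r F ⊻ cU r F := by
  ext A
  rw [mem_sups]
  constructor
  · intro hA
    refine ⟨A \ cM r F, sdiff_cM_mem_cL_of_mem_proj htw hcore hC hA, A ∩ cM r F,
      inter_cM_mem_cU_of_mem_proj htw hcore hC hA, ?_⟩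
    rw [sup_eq_union, sdiff_union_inter]
  · rintro ⟨x, hx, y, hy, rfl⟩
    rw [sup_eq_union]
    exact union_mem_proj htw hcore hC hx hy

/-- **The `r`-free members form the product `L ⊻ U₀`** (Addendum 57 §2). -/
theorem part0_eq_sups_cL_cU0 (htw : ∀ a b, Twin F a b → a = b) (hcore : ∀ a, ∃ t ∈ F, a ∉ t)
    (hC : Tight (completion0 r F)) : part0 r F = cL r F ⊻ cU0 r F := by
  ext A
  rw [mem_sups]
  constructor
  · intro hA
    refine ⟨A \ cM r F, sdiff_cM_mem_cL_of_mem_proj htw hcore hC (mem_proj_of_mem_part0 hA),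
      A ∩ cM r F, inter_cM_mem_cU0_of_mem_part0 htw hcore hC hA, ?_⟩
    rw [sup_eq_union, sdiff_union_inter]
  · rintro ⟨x, hx, y, hy, rfl⟩
    rw [sup_eq_union]
    exact union_mem_part0 htw hcore hC hx hy

end Coords

end PercRepro.MSTight
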